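import Mathlib
import Summits.CriticalPhenomena.SAWScalingLimit.Theorems.SAWMassiveIsingTiltTiltLawBasic

/-!
# Stub `differentiable_zloop` of crux `CriticalCurveContinuity` — the loop-gas weight is a polynomial

Route `SAWMassiveIsingTilt` of `CriticalPhenomena/SAWScalingLimit`; this file is the calculus stub
`differentiable_zloop` of line `registered` of the crux `CriticalCurveContinuity`
(stmt-CriticalPhenomena-7686). Objects (`Zloop`) are those of `Theorems/SAWMassiveIsingTiltDefs.lean`.

For a bounded domain `Ω` and a nonzero mesh `δ` the family of even subgraphs of `Ω_δ ⊆ δℍ` inside a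
vertex set `S` is finite (`finite_setOf_evenSubgraph`, from `Theorems/SAWMassiveIsingTiltTiltLawBasic`),
so the loop-`O(1)` partition function `y ↦ Zloop(Ω_δ, S; y) = Σ_E y ^ |E|` is an honest finite sum of
monomials (`zloop_eq_finset_sum`), i.e. a polynomial in the edge weight `y`, hence differentiable
(`differentiable_zloop`). This is the input of the skeleton's glue `hasDerivAt_tiltExpectation`, which
differentiates the finite-mesh tilted expectations in `y` through `deriv (fun t => Zloop … t) y`.
-/

noncomputable section

open MeasureTheory Filter Topology Set
open scoped NNReal ENNReal BoundedContinuousFunction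
open Literature.Probability Literature.Probability.LatticeModels
  Literature.Probability.RandomPlanarGeometry

namespace Summit.CriticalPhenomena.SAWScalingLimit.Theorems.SAWMassiveIsingTilt

/-- For bounded `Ω` and `δ ≠ 0`, `Zloop(Ω_δ, S; y)` is the finite sum `Σ_E y ^ |E|` over the finite
family of even subgraphs of `Ω_δ` inside `S`. -/
theorem zloop_eq_finset_sum {Ω : Set ℂ} (hΩ : Bornology.IsBounded Ω) {δ : ℝ} (hδ : δ ≠ 0)
    (S : Set HexVertex) (y : ℝ) :
    Zloop (SAW.hexDomainGraph Ω δ) S y =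
      ∑ E ∈ (finite_setOf_evenSubgraph hΩ hδ S).toFinset, y ^ E.card := by
  unfold Zloop
  rw [finsum_mem_eq_finite_toFinset_sum _ (finite_setOf_evenSubgraph hΩ hδ S)]

/-- **Stub `differentiable_zloop`**: the loop-gas partition function `y ↦ Zloop(Ω_δ, S; y)` of a
bounded domain at a nonzero mesh is differentiable (it is a polynomial in `y`). -/
theorem differentiable_zloop :
    ∀ {Ω : Set ℂ}, Bornology.IsBounded Ω → ∀ {δ : ℝ}, δ ≠ 0 → ∀ S : Set HexVertex,
      Differentiable ℝ (fun y => Zloop (SAW.hexDomainGraph Ω δ) S y) := by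
  intro Ω hΩ δ hδ S
  have h : (fun y => Zloop (SAW.hexDomainGraph Ω δ) S y) =
      fun y => ∑ E ∈ (finite_setOf_evenSubgraph hΩ hδ S).toFinset, y ^ E.card :=
    funext fun y => zloop_eq_finset_sum hΩ hδ S y
  rw [h]
  exact Differentiable.fun_sum fun E _ => differentiable_pow E.card

end Summit.CriticalPhenomena.SAWScalingLimit.Theorems.SAWMassiveIsingTilt

end
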